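import Summits.PneNP.PneNP.Theorems.ReslinSizeFromWidthPCDegreeConsequences
import Literature.Computability.MetaComplexity.FunctionalPigeonholeDegree
import HarnessLib

/-!
# PneNP / ReslinSizeFromWidth — the PC rail with its second printed input: functional pigeonhole principles (conditional on Mikša–Nordström 2015)

Helper file for the INPUT side of crux `ResLinSizeFromWidth` (stmt-PneNP-18932); companion of
`ReslinSizeFromWidthPCDegreeGOP.lean` (graph ordering principles, Galesi–Lauria 2010).  Here the
named fact is `MiksaNordstrom2015_PC_FPHP_degree` (`Literature/…/FunctionalPigeonholeDegree.lean`: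
MN15 Thm 4.9 — over a bipartite `(s, δ)`-boundary expander with left degrees `≤ d`, the graph
functional pigeonhole principle `FPHP_G` has no PC refutation of degree `≤ δs/(2d)` over any
field).  CONDITIONAL results (hypothesis `hMN`): for `N : Fin m → Finset (Fin n)` such an expander
(`s ≥ 1`, `δ > 0`, `1 ≤ d`), `t = max d 2` (the clause width of `FPHP_G`) and an integer
`k ≤ δs/(2d)`,

* every Res(⊕) refutation of `FPHP_G` has a line of rank `≥ k` when `t ≤ k`
  (`resLinWidth_fphpCNF`, `le_minResLinWidth_fphpCNF`);
* every configuration-style Res(⊕) refutation has clause space `≥ k + 1 - t` when `t < k`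
  (`clauseSpace_fphpCNF`) — the shape of GOR's Thm 11 ("Space(FPHP) = Ω(n)") before the
  restriction argument;
* tree-like size `≥ 2^(k-t-1)` (`treeLike_length_fphpCNF`), quadratic dag-like law
  (`quadratic_length_fphpCNF`).

Not here: GOR's restriction step `FPHP^{n+1}_n ↾ρ_G = FPHP_G` and explicit boundary expanders
(both needed for the unconditional-modulo-MN15 statement about `FPHP^{n+1}_n`); any discharge.

References: M. Mikša, J. Nordström, CCC 2015, Thm 4.9; S. Gryaznov, S. Ovcharov, A. Riazanov,
ACM ToCT (2024), §4.1.2 (Thm 10, Thm 11).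
-/

noncomputable section

namespace Summit.PneNP.PneNP.Theorems

-- `Summit.PneNP.PneNP` repeats a path component by design (summit = sub-problem); silence the linter.
set_option linter.dupNamespace false

namespace ResLinPC

open Literature.Computability.Complexity Literature.Computability.MetaComplexity
open Summit.PneNP.PneNP.Theorems.PolyCalc

variable {m n : ℕ} (N : Fin m → Finset (Fin n)) {s δ : ℝ} {d k : ℕ}

/-- Under MN15 Thm 4.9: the clause polynomials of `FPHP_G` over `𝔽₂` have no PC refutation of
degree `≤ k` whenever `k ≤ δs/(2d)`. [Mikša–Nordström 2015, Thm 4.9 — hypothesis] -/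
theorem not_refutableInDegree_fphpCNF (hMN : MiksaNordstrom2015_PC_FPHP_degree) (hs : 1 ≤ s)
    (hδ : 0 < δ) (hd : 1 ≤ d) (hdeg : ∀ u, (N u).card ≤ d)
    (hG : IsBoundaryExpander (FPHP.holeScope N) s δ) (hk : (k : ℝ) ≤ δ * s / (2 * d)) :
    ¬ PC.RefutableInDegree (cnfPolys (ZMod 2) (FPHP.fphpCNF N)) k := by
  -- the Summits-side translation `cnfPolys` is the Literature `PC.ofCNF` (same terms)
  rw [show cnfPolys (ZMod 2) (FPHP.fphpCNF N) = PC.ofCNF (ZMod 2) (FPHP.fphpCNF N) from rfl]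
  exact hMN.not_refutable (ZMod 2) N hs hδ hd hdeg hG hk

/-- **Res(⊕) rank of graph functional pigeonhole principles** (conditional on MN15 Thm 4.9):
`max d 2 ≤ k ≤ δs/(2d)` ⇒ every Res(⊕) refutation of `FPHP_G` contains a line of rank `≥ k`.
[Gryaznov–Ovcharov–Riazanov 2024, §4.1 (large PC degree ⇒ large Res(⊕) width)] -/
theorem resLinWidth_fphpCNF (hMN : MiksaNordstrom2015_PC_FPHP_degree) (hs : 1 ≤ s) (hδ : 0 < δ)
    (hd : 1 ≤ d) (hdeg : ∀ u, (N u).card ≤ d) (hG : IsBoundaryExpander (FPHP.holeScope N) s δ)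
    (htk : max d 2 ≤ k) (hk : (k : ℝ) ≤ δ * s / (2 * d)) {π : List ResLinLine}
    (hπ : IsResLinRefutation (FPHP.fphpCNF N) π) : k ≤ resLinWidth π :=
  resLin_rank_of_pcDegree (fun c hc => (FPHP.isWidthLE_fphpCNF N hdeg c hc).trans htk)
    (not_refutableInDegree_fphpCNF N hMN hs hδ hd hdeg hG hk) hπ

/-- The same for the minimal refutation width (`ℕ∞`). -/
theorem le_minResLinWidth_fphpCNF (hMN : MiksaNordstrom2015_PC_FPHP_degree) (hs : 1 ≤ s)
    (hδ : 0 < δ) (hd : 1 ≤ d) (hdeg : ∀ u, (N u).card ≤ d)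
    (hG : IsBoundaryExpander (FPHP.holeScope N) s δ) (htk : max d 2 ≤ k)
    (hk : (k : ℝ) ≤ δ * s / (2 * d)) : (k : ℕ∞) ≤ minResLinWidth (FPHP.fphpCNF N) :=
  le_minResLinWidth_iff.2 fun _ hπ => resLinWidth_fphpCNF N hMN hs hδ hd hdeg hG htk hk hπ

/-- **Res(⊕) clause space of graph functional pigeonhole principles** (conditional on MN15
Thm 4.9): `max d 2 < k ≤ δs/(2d)` ⇒ clause space `≥ k + 1 - max d 2`. [Gryaznov–Ovcharov–Riazanov
2024, Thm 11 (shape, before the restriction argument)] -/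
theorem clauseSpace_fphpCNF (hMN : MiksaNordstrom2015_PC_FPHP_degree) (hs : 1 ≤ s) (hδ : 0 < δ)
    (hd : 1 ≤ d) (hdeg : ∀ u, (N u).card ≤ d) (hG : IsBoundaryExpander (FPHP.holeScope N) s δ)
    (htk : max d 2 + 1 ≤ k) (hk : (k : ℝ) ≤ δ * s / (2 * d)) {ϖ : List (Finset LinClause)}
    (hϖ : IsResLinSpaceRefutation (FPHP.fphpCNF N) ϖ) : k + 1 - max d 2 ≤ resLinClauseSpace ϖ :=
  clauseSpace_of_pcDegree (FPHP.isWidthLE_fphpCNF N hdeg) htk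
    (not_refutableInDegree_fphpCNF N hMN hs hδ hd hdeg hG hk) hϖ

/-- **Tree-like Res(⊕) size of graph functional pigeonhole principles** (conditional on MN15
Thm 4.9): at least `2^(k - max d 2 - 1)` lines. [Efremenko–Garlík–Itsykson 2024, §1.1.1 (the method:
"degree lower bounds for … the functional graph pigeonhole principle [35] imply exponential lower
bounds on the size of tree-like Res(⊕) proofs")] -/
theorem treeLike_length_fphpCNF (hMN : MiksaNordstrom2015_PC_FPHP_degree) (hs : 1 ≤ s)
    (hδ : 0 < δ) (hd : 1 ≤ d) (hdeg : ∀ u, (N u).card ≤ d)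
    (hG : IsBoundaryExpander (FPHP.holeScope N) s δ) (htk : max d 2 ≤ k)
    (hk : (k : ℝ) ≤ δ * s / (2 * d)) {π : List ResLinLine}
    (hπ : IsResLinRefutation (FPHP.fphpCNF N) π)
    (htree : ∀ i : ℕ, (π.map fun l => l.premises.count i).sum ≤ 1) :
    2 ^ (k - max d 2 - 1) ≤ π.length :=
  treeLike_length_of_pcDegree (FPHP.isWidthLE_fphpCNF N hdeg) htk
    (not_refutableInDegree_fphpCNF N hMN hs hδ hd hdeg hG hk) hπ htree

/-- **Dag-like Res(⊕) size of graph functional pigeonhole principles, quadratic law** (conditional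
on MN15 Thm 4.9). -/
theorem quadratic_length_fphpCNF (hMN : MiksaNordstrom2015_PC_FPHP_degree) (hs : 1 ≤ s)
    (hδ : 0 < δ) (hd : 1 ≤ d) (hdeg : ∀ u, (N u).card ≤ d)
    (hG : IsBoundaryExpander (FPHP.holeScope N) s δ) (htk : max d 2 + 1 ≤ k)
    (hk : (k : ℝ) ≤ δ * s / (2 * d)) {π : List ResLinLine}
    (hπ : IsResLinRefutation (FPHP.fphpCNF N) π) :
    2 + (k - 1) * k ≤ 2 * π.length + max d 2 * (max d 2 + 1) :=
  quadratic_length_of_pcDegree (FPHP.isWidthLE_fphpCNF N hdeg) htk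
    (not_refutableInDegree_fphpCNF N hMN hs hδ hd hdeg hG hk) hπ

end ResLinPC

end Summit.PneNP.PneNP.Theorems
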